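import Summits.BirchSwinnertonDyer.BirchSwinnertonDyer.Theorems.ErratumRoadFiveEulerHalfGenusEprimePointsR
import Summits.BirchSwinnertonDyer.BirchSwinnertonDyer.Theorems.ErratumRoadFiveEulerHalfAuxNormE0PrimeOfTrace
import Summits.BirchSwinnertonDyer.BirchSwinnertonDyer.Theorems.ErratumRoadFiveCarrierLocalE0OddPrime
import Summits.BirchSwinnertonDyer.BirchSwinnertonDyer.Theorems.ClassRecordThreeEulerHalvesAtThreeShimuraE0ReceptacleOfLabelB6
import Summits.BirchSwinnertonDyer.Rank1Residual.JET.HeegnerE0ReceptacleByName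
import Summits.BirchSwinnertonDyer.BirchSwinnertonDyer.Theorems.Rank1ResidualJetRingClassFields
import HarnessLib

/-!
# Route `ErratumRoadFive`, crux `EulerHalfPOnlyMultPotMultTwinAtFive` (23444), line `genus`, stub S4♯, child (a):
# the CM-span Néron label (E′) at the carrier `p` AT KOLYVAGIN LEVELS, from KERNEL THEOREMS by the auxiliary-norm lever
# (seat `bsd-idea-9` g24, line owner; helper `--supports 23444 --as helper`)

THEOREMS ONLY (no definition, no named fact, no `sorry`). Third file of the S4♯ package after the engine
`GenusSharpKolyvagin.hpointsEprime_of_shimuraLabels_kolyvaginGuarded` (p698102) and the presentation theorem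
`GenusKolyvagin.genusKolyvaginEprimePointsR_of_presentation` (p699288), whose hypothesis `hE0W` — the (E′) label on the CM span of
`W = C₂ • (D • E′)^{(d₁)}` at the places `v ∣ p` — this file DISCHARGES at every square-free level all of whose prime factors are
Kolyvagin primes (the only levels at which the engine consumes it: `lev m ∈ Kol`), with NO printed fact and NO label as hypothesis.

WHAT. `genusCMSpanNeron_of_auxNorm`: in the genus presentation (`W = C₂ • (D • E′)^{(d₁)}` globally minimal, `d_K = d₁ d₂` a genus
factorisation, datum `Dt` on `E′` with a Birch orientation `β`, a root `θ = √d₁ ∈ K[1]`), for a prime `p ≥ 5` with `ρ̄_{W,p}` onto,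
`p` SPLIT in `K`, and `W` split multiplicative at `p` with `p ∣ ord_p Δ_W = c_p(W)`: there is ONE integer `n′` prime to `p` such that
for every square-free `m` whose prime factors are Kolyvagin primes for `(W, K, p)`, every `E′`-point `Q` over `K[m]` presenting the CM
point of conductor `m`, every root `ϑ′ = ±√d₁ ∈ K[m]`, every `ℚ`-embedding `f : K[m] → K̄` and every place `v ∣ p` of `K`:
`n′ · f(Θ_{ϑ′} Q) ∈ E0Receptacle (W⁄K) v` — VERBATIM the body of p699288's binder `hE0W` at those levels.

HOW (bsd-idea-9's auxiliary-norm lever «an auxiliary norm kills the component», run on the TRANSPORTED genus family of `W` at the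
carrier `q := p`). `subst` the presentation. The `E′`-points `y_{E′}(m) ∈ E′(K[m])` over the CM points exist at every `m ≠ 0`
(Darmon Thm 3.6, kernel theorem `phi_heegnerPointOfConductor_mem_range_map_ringClassField_of_ne_zero`); for each sign `u = ±1` the
roots `ϑ^u_m = u·χ(m)·θ↑` give the bare family `Y^u(m) = Θ_{ϑ^u_m}(y_{E′}(m)) ∈ W(K[m])`, which satisfies the norm relation (B4) at the
square-free levels with prime factors `∤ N♭ := 2·N_W·N_{E′}·|d₁|` inert in `K` (`label_B4_level`, p675176). The local inputs at the
carrier: (T), (C) on the whole ring class tower at the K-split prime `p` with `c := c_p(W ⊗ ℚ_p)`, `p ∣ c`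
(`CarrierLocalE0OddPrime.carrierLocalE0_ringClassField_of_odd_prime_dvd`, p646245-package), and the auxiliary inert level
(`AuxNormReceptacle.auxiliaryInertLevel_of_laws` from `relativeStabilizerLaw` and `AuxPrimeSupply.auxiliaryPrimeSupply`). The bare
composition `ShimuraWalk.labelE0Prime_at_carrier_of_trace_of_galTrivial_of_kills_of_auxLevel` then gives `n_u` prime to `p` with
`n_u · Y^u(m) ∈ E₀(K[m])_w` for all `w ∣ p`; `n′ := n_+ n_-`. At a Kolyvagin level every prime factor is odd, `∤ N_W`, `∤ d_K ⊇ d₁`, inert,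
hence good for `E′ ≅ W^{(d₁)}` — so the level is `N♭`-admissible; `Q = y_{E′}(m)` (`E′(K[m]) → E′(ℂ)` injective) and `ϑ′ = ϑ^{±}_m`
(`ϑ′² = ϑ²` in a field); finally `E₀(K[m])_w (w ∣ p) → E0Receptacle (W⁄K) v` along `f` (`JET.pointsMap_map_mem_E0Receptacle_of_forall_place`,
minimality of `W ⊗ K_v` at the split prime from `ShimuraKolyvaginOfImage.natCast_mem_and_isMinimal_of_split`).
HONEST FRAMING: a theorem about Néron components of transported CM points; nothing about `Ш`, no index, no rank hypothesis, no printed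
fact enters; it discharges hypothesis (E′) of p699288 at the Kolyvagin levels only (conductor-one and non-Kolyvagin levels are NOT
claimed). BSD is proved for no curve by this file.
[cite: GrossLMS1991, §3 Prop. 3.7 (1), §6 p. 245] [cite: GrossZagier1986, III (3.1)] [cite: Darmon2004, Thm. 3.6]
[cite: SilvermanATAEC1994, IV Cor. 9.2 (d)] [cite: SilvermanAEC2009, VII.1 Prop. 1.3 (b), VII.6 Thm. 6.1] [cite: Cox2013, §7.D Thm. 7.24, §9.A]
presearch: «Heegner point genus character identity component Néron auxiliary prime norm relation» → [corpus: GrossLMS1991 §3, §6]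
(untwisted, Heegner hypothesis); `lean search 'labelE0Prime_at_carrier_of_trace'` → the bare aux-norm theorem only (no genus/twisted use).
-/

noncomputable section

open scoped Classical ComplexConjugate

set_option linter.dupNamespace false
set_option autoImplicit false

namespace Summit.BirchSwinnertonDyer.BirchSwinnertonDyer.Theorems.GenusKolyvagin

open WeierstrassCurve NumberField Field IsDedekindDomain Literature.NumberTheory.EllipticCurves
  Literature.NumberTheory.EllipticCurves.ModularForms Literature.NumberTheory.GaloisRepresentations
  Summit.BirchSwinnertonDyer.Rank1Residual.X11b

variable {K : Type} [Field K] [NumberField K]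

set_option maxHeartbeats 1600000 in
/-- **(E′) on the CM span of `W = C₂ • (D • E′)^{(d₁)}` at `v ∣ p`, at every Kolyvagin level, by the auxiliary-norm lever** — see the
module docstring. [cite: GrossLMS1991, §3 Prop. 3.7 (1), §6 p. 245] [cite: GrossZagier1986, III (3.1)] [cite: SilvermanATAEC1994, IV Cor. 9.2 (d)] -/
theorem genusCMSpanNeron_of_auxNorm
    (W : WeierstrassCurve ℚ) [W.IsElliptic] [W.IsGloballyMinimal] {p : ℕ} [Fact p.Prime] (hp5 : 5 ≤ p)
    (hsurj : W.HasSurjectiveModNGaloisRep p)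
    (hsplit : W.HasSplitMultiplicativeReductionAtPrime p) (hpval : p ∣ padicValInt p W.minimalDiscriminantInt)
    (hK : IsImaginaryQuadratic K) (ι : K →+* ℂ) (hsp : ((Ideal.span {(p : ℤ)}).primesOver (𝓞 K)).ncard = 2)
    (E' : WeierstrassCurve ℚ) [E'.IsElliptic] [E'.IsGloballyMinimal] [NeZero (E'.conductorNorm ℤ)]
    (D C₂ : VariableChange ℚ) [(D • E').IsCharNeTwoNF] {d₁ d₂ : ℤ}
    (hd₁s : (d₁ % 4 = 1 ∧ Squarefree d₁ ∧ d₁ ≠ 1) ∨ (4 ∣ d₁ ∧ (d₁ / 4 % 4 = 2 ∨ d₁ / 4 % 4 = 3) ∧ Squarefree (d₁ / 4)))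
    (hd₂s : (d₂ % 4 = 1 ∧ Squarefree d₂ ∧ d₂ ≠ 1) ∨ (4 ∣ d₂ ∧ (d₂ / 4 % 4 = 2 ∨ d₂ / 4 % 4 = 3) ∧ Squarefree (d₂ / 4)))
    (hd : d₁ * d₂ = NumberField.discr K)
    (hE' : ∃ C : VariableChange ℚ, C • W.quadraticTwist (d₁ : ℚ) = E')
    (hWd : C₂ • (D • E').quadraticTwist (d₁ : ℚ) = W)
    (Dt : ModularParametrizationData E' (E'.conductorNorm ℤ)) {β : ℤ}
    (hβ : (4 * (E'.conductorNorm ℤ : ℤ)) ∣ β ^ 2 - NumberField.discr K)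
    {θ : ringClassField K ι 1} (hθ2 : θ ^ 2 = algebraMap ℚ (ringClassField K ι 1) (d₁ : ℚ)) (hθ0 : θ ≠ 0) :
    ∃ n' : ℤ, IsCoprime (p : ℤ) n' ∧ ∀ (m : ℕ), Squarefree m →
      (∀ r ∈ m.primeFactors, IsKolyvaginPrime (W.conductorNorm ℤ) W K p r) →
      ∀ (Q : (E'.baseChange (ringClassField K ι m)).toAffine.Point),
      Affine.Point.map (ringClassField K ι m).subtype.toRatAlgHom Q =
        heegnerPointComplexOfConductor Dt (NumberField.discr K) β m →
      ∀ (ϑ' : ringClassField K ι m) (hϑ'2 : ϑ' ^ 2 = algebraMap ℚ (ringClassField K ι m) (d₁ : ℚ)) (hϑ'0 : ϑ' ≠ 0)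
        (f : ringClassField K ι m →ₐ[ℚ] AlgebraicClosure K) (v : HeightOneSpectrum (𝓞 K)),
        ((p : ℕ) : 𝓞 K) ∈ v.asIdeal →
        n' • pointsMap (W.baseChange K) (v.adicCompletion K)
          (Affine.Point.map (W' := W) f
            (Affine.Point.congrEquiv
              (congrArg (fun X : WeierstrassCurve ℚ ↦ X.baseChange (ringClassField K ι m : Type)) hWd)
              (VariableChange.pointEquivBaseChange ((D • E').quadraticTwist (d₁ : ℚ)) C₂ (ringClassField K ι m)
                ((VariableChange.pointEquiv (((D • E').quadraticTwist (d₁ : ℚ)).baseChange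
                    (ringClassField K ι m : Type)) (untwistAt hϑ'0)).symm
                  ((Affine.Point.congrEquiv (untwistAt_smul_eq (D • E') hϑ'2 hϑ'0)).symm
                    (VariableChange.pointEquivBaseChange E' D (ringClassField K ι m) Q)))))) ∈
          E0Receptacle (W.baseChange K) v := by
  subst hWd
  have hD4 : NumberField.discr K < -4 := GenusKolyvaginRC.discr_lt_neg_four_of_genus hK hd₁s hd₂s hd
  have hd₁ : d₁ ∣ NumberField.discr K := hd ▸ dvd_mul_right d₁ d₂
  -- §0 basic data
  have hp : p.Prime := Fact.out
  have hp2 : p ≠ 2 := by omega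
  haveI : NeZero ((C₂ • (D • E').quadraticTwist (d₁ : ℚ)).conductorNorm ℤ) := ⟨(WeierstrassCurve.conductorNorm_pos_holds _).ne'⟩
  haveI hnfj : ∀ j : ℕ, NumberField (ringClassField K ι j) :=
    Summit.BirchSwinnertonDyer.Rank1Residual.JET.numberField_ringClassField K hK ι
  have hd10 : d₁ ≠ 0 := by
    rintro rfl
    exact hθ0 (pow_eq_zero_iff (n := 2) (by norm_num) |>.mp (by rw [hθ2]; simp))
  -- the admissibility modulus `N♭ = 2·N_W·N_{E′}·|d₁|` of the bare norm relation
  obtain ⟨Nb, hNbdef⟩ : ∃ N : ℕ, N = 2 * (C₂ • (D • E').quadraticTwist (d₁ : ℚ)).conductorNorm ℤ * E'.conductorNorm ℤ * d₁.natAbs :=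
    ⟨_, rfl⟩
  have h2N : 2 ∣ Nb := hNbdef ▸ dvd_mul_of_dvd_left (dvd_mul_of_dvd_left (dvd_mul_right 2 _) _) _
  have hWN : (C₂ • (D • E').quadraticTwist (d₁ : ℚ)).conductorNorm ℤ ∣ Nb :=
    hNbdef ▸ dvd_mul_of_dvd_left (dvd_mul_of_dvd_left (dvd_mul_left _ 2) _) _
  have hEN : E'.conductorNorm ℤ ∣ Nb := hNbdef ▸ dvd_mul_of_dvd_left (dvd_mul_left _ _) _
  have hdN : d₁.natAbs ∣ Nb := hNbdef ▸ dvd_mul_left _ _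
  have hNb0 : Nb ≠ 0 := hNbdef ▸
    mul_ne_zero (mul_ne_zero (mul_ne_zero two_ne_zero (NeZero.ne _)) (NeZero.ne _)) (Int.natAbs_ne_zero.mpr hd10)
  have hpN : p ∣ (C₂ • (D • E').quadraticTwist (d₁ : ℚ)).conductorNorm ℤ :=
    ((C₂ • (D • E').quadraticTwist (d₁ : ℚ)).dvd_conductorNorm_iff_not_hasGoodReductionAtPrime p).mpr
      (Literature.NumberTheory.EllipticCurves.Rank1Residual.not_hasGoodReductionAtPrime_of_hasMultiplicativeReductionAtPrime
        (W := C₂ • (D • E').quadraticTwist (d₁ : ℚ)) p hsplit.hasMultiplicativeReductionAtPrime)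
  have hpNb : p ∣ Nb := hpN.trans hWN
  -- the carrier's local data: `c := c_p(W ⊗ ℚ_p) = ord_p Δ_W ≠ 0`, `p ∣ c`; (T), (C); the auxiliary inert level
  haveI : ((C₂ • (D • E').quadraticTwist (d₁ : ℚ)).baseChange ℚ_[p]).IsElliptic :=
    inferInstanceAs ((C₂ • (D • E').quadraticTwist (d₁ : ℚ)).map (algebraMap ℚ ℚ_[p])).IsElliptic
  obtain ⟨vp, hvp⟩ : ∃ v : HeightOneSpectrum ℤ, (Rat.HeightOneSpectrum.primesEquiv v : ℕ) = p :=
    ⟨(Rat.HeightOneSpectrum.primesEquiv (R := ℤ)).symm ⟨p, hp⟩, by rw [Equiv.apply_symm_apply]⟩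
  have hcp : ((C₂ • (D • E').quadraticTwist (d₁ : ℚ)).baseChange ℚ_[p]).localTamagawaNumber ℤ_[p] =
      padicValInt p (C₂ • (D • E').quadraticTwist (d₁ : ℚ)).minimalDiscriminantInt :=
    localTamagawaNumber_eq_padicValInt_of_split (C₂ • (D • E').quadraticTwist (d₁ : ℚ)) vp hvp hsplit
  have hc0 : ((C₂ • (D • E').quadraticTwist (d₁ : ℚ)).baseChange ℚ_[p]).localTamagawaNumber ℤ_[p] ≠ 0 :=
    localTamagawaNumber_padic_ne_zero_holds p _
  have hpc : p ∣ ((C₂ • (D • E').quadraticTwist (d₁ : ℚ)).baseChange ℚ_[p]).localTamagawaNumber ℤ_[p] := by rw [hcp]; exact hpval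
  obtain ⟨hT, hC⟩ := CarrierLocalE0OddPrime.carrierLocalE0_ringClassField_of_odd_prime_dvd
    (C₂ • (D • E').quadraticTwist (d₁ : ℚ)) K ι hK p hp hp2 hpc hsp
  have hAux : AuxNormReceptacle.AuxiliaryInertLevel (C₂ • (D • E').quadraticTwist (d₁ : ℚ)) K ι p p Nb :=
    AuxNormReceptacle.auxiliaryInertLevel_of_laws (C₂ • (D • E').quadraticTwist (d₁ : ℚ)) K ι hK hpNb
      (AuxNormReceptacle.relativeStabilizerLaw hK ι p)
      (AuxPrimeSupply.auxiliaryPrimeSupply (C₂ • (D • E').quadraticTwist (d₁ : ℚ)) K hK hD4 p hp5 hsurj p hsp Nb hNb0)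
  -- §1 the `E′`-points over the CM points at every level `m ≠ 0` (kernel theorem, Darmon Thm. 3.6)
  have hex : ∀ m : ℕ, m ≠ 0 → ∃ Q : (E'.baseChange (ringClassField K ι m)).toAffine.Point,
      Affine.Point.map (ringClassField K ι m).subtype.toRatAlgHom Q = heegnerPointComplexOfConductor Dt (NumberField.discr K) β m :=
    fun m hm ↦ phi_heegnerPointOfConductor_mem_range_map_ringClassField_of_ne_zero (E'.conductorNorm ℤ) E' K hK Dt β ι m hβ hm
  choose yE hyE using hex
  -- §2 the signed roots `ϑ^u_m = u·χ(m)·θ↑`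
  have h1m : ∀ m : ℕ, m ≠ 0 → ringClassField K ι 1 ≤ ringClassField K ι m := fun m hm ↦ ringClassField_mono hK ι (one_dvd m) hm
  obtain ⟨χ, hχdef⟩ : ∃ χ : ℕ → ℤ, ∀ m, χ m = if jacobiSym d₁ m = -1 then -1 else 1 := ⟨_, fun _ ↦ rfl⟩
  have hχ1 : ∀ m, χ m = 1 ∨ χ m = -1 := fun m ↦ by rw [hχdef]; exact levelSign_eq_one_or d₁ m
  have hχ : ∀ (u : ℤ), u = 1 ∨ u = -1 → ∀ m, u * χ m = 1 ∨ u * χ m = -1 := fun u hu m ↦ by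
    rcases hu with rfl | rfl <;> rcases hχ1 m with h | h <;> simp [h]
  obtain ⟨ϑ, hϑdef⟩ : ∃ ϑ : ℤ → (m : ℕ) → m ≠ 0 → ringClassField K ι m, ∀ u m (hm : m ≠ 0),
      ϑ u m hm = ((u * χ m : ℤ) : ringClassField K ι m) * RingClassField.inclusion ι (h1m m hm) θ :=
    ⟨fun u m hm ↦ ((u * χ m : ℤ) : ringClassField K ι m) * RingClassField.inclusion ι (h1m m hm) θ, fun _ _ _ ↦ rfl⟩
  have hϑ2 : ∀ (u : ℤ) (_ : u = 1 ∨ u = -1) (m : ℕ) (hm : m ≠ 0), ϑ u m hm ^ 2 = algebraMap ℚ (ringClassField K ι m) (d₁ : ℚ) :=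
    fun u hu m hm ↦ root_sq_eq ι (h1m m hm) (hχ u hu m) hθ2 (hϑdef u m hm)
  have hϑ0 : ∀ (u : ℤ) (_ : u = 1 ∨ u = -1) (m : ℕ) (hm : m ≠ 0), ϑ u m hm ≠ 0 :=
    fun u hu m hm ↦ root_ne_zero ι (h1m m hm) (hχ u hu m) hθ0 (hϑdef u m hm)
  have hϑC : ∀ (u : ℤ) (m : ℕ) (hm : m ≠ 0), (ϑ u m hm : ℂ) = ((u * χ m : ℤ) : ℂ) * (θ : ℂ) :=
    fun u m hm ↦ coe_root ι (h1m m hm) (hϑdef u m hm)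
  -- §3 the two transported families `Y^u(m) = Θ_{ϑ^u_m}(y_{E′}(m))`
  obtain ⟨Y, hYdef⟩ : ∃ Y : (u : ℤ) → (u = 1 ∨ u = -1) → (m : ℕ) →
      ((C₂ • (D • E').quadraticTwist (d₁ : ℚ)).baseChange (ringClassField K ι m)).toAffine.Point,
      ∀ u hu m, Y u hu m = if hm : m ≠ 0 then
        (VariableChange.pointEquivBaseChange ((D • E').quadraticTwist (d₁ : ℚ)) C₂ (ringClassField K ι m)
          ((VariableChange.pointEquiv (((D • E').quadraticTwist (d₁ : ℚ)).baseChange (ringClassField K ι m))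
              (untwistAt (hϑ0 u hu m hm))).symm
            ((Affine.Point.congrEquiv (untwistAt_smul_eq (D • E') (hϑ2 u hu m hm) (hϑ0 u hu m hm))).symm
              (VariableChange.pointEquivBaseChange E' D (ringClassField K ι m) (yE m hm))))) else 0 :=
    ⟨fun u hu m ↦ if hm : m ≠ 0 then
        (VariableChange.pointEquivBaseChange ((D • E').quadraticTwist (d₁ : ℚ)) C₂ (ringClassField K ι m)
          ((VariableChange.pointEquiv (((D • E').quadraticTwist (d₁ : ℚ)).baseChange (ringClassField K ι m))
              (untwistAt (hϑ0 u hu m hm))).symm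
            ((Affine.Point.congrEquiv (untwistAt_smul_eq (D • E') (hϑ2 u hu m hm) (hϑ0 u hu m hm))).symm
              (VariableChange.pointEquivBaseChange E' D (ringClassField K ι m) (yE m hm))))) else 0, fun _ _ _ ↦ rfl⟩
  have hY : ∀ u hu m (hm : m ≠ 0), Y u hu m =
      (VariableChange.pointEquivBaseChange ((D • E').quadraticTwist (d₁ : ℚ)) C₂ (ringClassField K ι m)
        ((VariableChange.pointEquiv (((D • E').quadraticTwist (d₁ : ℚ)).baseChange (ringClassField K ι m))
            (untwistAt (hϑ0 u hu m hm))).symm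
          ((Affine.Point.congrEquiv (untwistAt_smul_eq (D • E') (hϑ2 u hu m hm) (hϑ0 u hu m hm))).symm
            (VariableChange.pointEquivBaseChange E' D (ringClassField K ι m) (yE m hm))))) :=
    fun u hu m hm ↦ by rw [hYdef, dif_pos hm]
  -- §4 the auxiliary-norm lever on each family: `n_u · Y^u(m) ∈ E₀(K[m])_w` for `w ∣ p` at the `N♭`-admissible levels
  have aux : ∀ (u : ℤ) (hu : u = 1 ∨ u = -1), ∃ n₀ : ℕ, ¬ p ∣ n₀ ∧ ∀ m : ℕ, Squarefree m →
      (∀ r ∈ m.primeFactors, ¬ r ∣ Nb ∧ (Ideal.span {(r : 𝓞 K)}).IsPrime) →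
      ∀ (w : HeightOneSpectrum (𝓞 (ringClassField K ι m))), ((p : ℕ) : 𝓞 (ringClassField K ι m)) ∈ w.asIdeal →
        (placeIntModel (C₂ • (D • E').quadraticTwist (d₁ : ℚ)) (ringClassField K ι m) w).HasNonsingularReduction
          (K := ringClassField K ι m) (n₀ • Y u hu m) := by
    intro u hu
    -- (B4) for `Y^u` at the admissible levels (p675176 `label_B4_level`)
    have hB4 : ∀ m : ℕ, Squarefree m → (∀ r ∈ m.primeFactors, ¬ r ∣ Nb ∧ (Ideal.span {(r : 𝓞 K)}).IsPrime) →
        ∀ (ℓ : ℕ) (_ : ℓ ∈ m.primeFactors) (hle : ringClassField K ι (m / ℓ) ≤ ringClassField K ι m)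
          (σ : ringClassField K ι m ≃ₐ[ℚ] ringClassField K ι m),
          Subgroup.zpowers σ = ringClassGalOver ι m (m / ℓ) →
          letI : Algebra K ℂ := ι.toAlgebra
          ∑ i ∈ Finset.range (ℓ + 1), pointGalHom (C₂ • (D • E').quadraticTwist (d₁ : ℚ)) (ringClassField K ι m) (σ ^ i) (Y u hu m) =
            (C₂ • (D • E').quadraticTwist (d₁ : ℚ)).frobeniusTrace ℓ •
              Affine.Point.map (W' := C₂ • (D • E').quadraticTwist (d₁ : ℚ))
                ((RingClassField.inclusion ι hle).restrictScalars ℚ) (Y u hu (m / ℓ)) := by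
      intro m hm hg ℓ hℓm hle σ hσ
      have hℓ : ℓ.Prime := Nat.prime_of_mem_primeFactors hℓm
      haveI : Fact ℓ.Prime := ⟨hℓ⟩
      have hm0 : m ≠ 0 := hm.ne_zero
      have hℓdvd : ℓ ∣ m := Nat.dvd_of_mem_primeFactors hℓm
      have hm'0 : m / ℓ ≠ 0 := fun h ↦ hm0 (by rw [← Nat.mul_div_cancel' hℓdvd, h, mul_zero])
      obtain ⟨hℓN, hinert⟩ := hg ℓ hℓm
      have hℓ2 : ℓ ≠ 2 := fun h ↦ hℓN (h ▸ h2N)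
      have hℓW : ¬ ℓ ∣ (C₂ • (D • E').quadraticTwist (d₁ : ℚ)).conductorNorm ℤ := fun h ↦ hℓN (h.trans hWN)
      have hℓE : ¬ ℓ ∣ E'.conductorNorm ℤ := fun h ↦ hℓN (h.trans hEN)
      have hℓd : ¬ (ℓ : ℤ) ∣ d₁ := fun h ↦ hℓN ((Int.ofNat_dvd_left.mp h).trans hdN)
      have hgoodW : (C₂ • (D • E').quadraticTwist (d₁ : ℚ)).HasGoodReductionAtPrime ℓ :=
        not_not.mp (mt ((C₂ • (D • E').quadraticTwist (d₁ : ℚ)).dvd_conductorNorm_iff_not_hasGoodReductionAtPrime ℓ).mpr hℓW)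
      have hgoodE : E'.HasGoodReductionAtPrime ℓ :=
        not_not.mp (mt (E'.dvd_conductorNorm_iff_not_hasGoodReductionAtPrime ℓ).mpr hℓE)
      have hmN : m.Coprime (E'.conductorNorm ℤ) :=
        (ModularAuxNorm.coprime_of_forall_primeFactors_not_dvd hm0 fun r hr hrN ↦ (hg r hr).1 (hrN.trans hEN)).symm
      have hgcd : d₁.gcd m = 1 :=
        ModularAuxNorm.coprime_of_forall_primeFactors_not_dvd (N := d₁.natAbs) hm0 fun r hr hrd ↦ (hg r hr).1 (hrd.trans hdN)
      have hχm : χ m = legendreSym ℓ d₁ * χ (m / ℓ) := by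
        rw [hχdef m, hχdef (m / ℓ)]; exact levelSign_eq_legendreSym_mul hℓdvd hm0 hgcd
      have hϑϑ' : (ϑ u m hm0 : ℂ) = (legendreSym ℓ d₁ : ℂ) * (ϑ u (m / ℓ) hm'0 : ℂ) := by
        rw [hϑC u m hm0, hϑC u (m / ℓ) hm'0, hχm]; push_cast; ring
      rw [hY u hu m hm0, hY u hu (m / ℓ) hm'0]
      exact label_B4_level hK ι hD4 E' D C₂ d₁ Dt hβ hm hℓm hℓ2 hinert hℓd hgoodW hgoodE hmN hle σ hσ
        (hϑ2 u hu m hm0) (hϑ0 u hu m hm0) (hϑ2 u hu (m / ℓ) hm'0) (hϑ0 u hu (m / ℓ) hm'0) hϑϑ' (hyE m hm0) (hyE (m / ℓ) hm'0)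
    obtain ⟨n₀, hn₀, h⟩ := ShimuraWalk.labelE0Prime_at_carrier_of_trace_of_galTrivial_of_kills_of_auxLevel
      (C₂ • (D • E').quadraticTwist (d₁ : ℚ)) ι hK hpNb hc0 (Y u hu) hB4 hT hC hAux
    exact ⟨n₀, hn₀, fun m hm hg w hw ↦ h m hm hg w hw⟩
  -- §5 assembly: `n′ := n_+ · n_-`
  obtain ⟨np, hnp, hYp⟩ := aux 1 (Or.inl rfl)
  obtain ⟨nm, hnm, hYm⟩ := aux (-1) (Or.inr rfl)
  refine ⟨((np * nm : ℕ) : ℤ), Nat.isCoprime_iff_coprime.mpr ((Nat.Prime.coprime_iff_not_dvd hp).mpr fun h ↦ ?_), ?_⟩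
  · rcases (Nat.Prime.dvd_mul hp).mp h with h | h
    exacts [hnp h, hnm h]
  intro m hm hKol Q hQ ϑ' hϑ'2 hϑ'0 f v hv
  have hm0 : m ≠ 0 := hm.ne_zero
  -- a Kolyvagin level is `N♭`-admissible
  have hg : ∀ r ∈ m.primeFactors, ¬ r ∣ Nb ∧ (Ideal.span {(r : 𝓞 K)}).IsPrime := by
    intro r hr
    have hK' := hKol r hr
    have hrp : r.Prime := Nat.prime_of_mem_primeFactors hr
    haveI : Fact r.Prime := ⟨hrp⟩
    have hr2 : r ≠ 2 := kolyvaginPrime_ne_two (C₂ • (D • E').quadraticTwist (d₁ : ℚ)) hp5 hp hK'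
    have hrd : ¬ (r : ℤ) ∣ d₁ := fun h ↦ hK'.2.2.1 (h.trans hd₁)
    have hrW : ¬ r ∣ (C₂ • (D • E').quadraticTwist (d₁ : ℚ)).conductorNorm ℤ := hK'.2.1
    have hgoodW : (C₂ • (D • E').quadraticTwist (d₁ : ℚ)).HasGoodReductionAtPrime r :=
      not_not.mp (mt ((C₂ • (D • E').quadraticTwist (d₁ : ℚ)).dvd_conductorNorm_iff_not_hasGoodReductionAtPrime r).mpr hrW)
    have hrE : ¬ r ∣ E'.conductorNorm ℤ := fun h ↦ (E'.dvd_conductorNorm_iff_not_hasGoodReductionAtPrime r).mp h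
      (hasGoodReductionAtPrime_of_twist_presentation (C₂ • (D • E').quadraticTwist (d₁ : ℚ)) E' hE' hr2 hrd hgoodW)
    refine ⟨fun h ↦ ?_, hK'.2.2.2.2.1⟩
    rw [hNbdef] at h
    rcases (Nat.Prime.dvd_mul hrp).mp h with h | h
    · rcases (Nat.Prime.dvd_mul hrp).mp h with h | h
      · rcases (Nat.Prime.dvd_mul hrp).mp h with h | h
        · exact hr2 ((Nat.prime_dvd_prime_iff_eq hrp Nat.prime_two).mp h)
        · exact hrW h
      · exact hrE h
    · exact hrd (Int.ofNat_dvd_left.mpr h)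
  -- the presented point IS `y_{E′}(m)` and the root is `ϑ^{±}_m`
  obtain rfl : Q = yE m hm0 :=
    Affine.Point.map_injective (f := (ringClassField K ι m).subtype.toRatAlgHom) (hQ.trans (hyE m hm0).symm)
  obtain ⟨hNv, hmin⟩ := ShimuraKolyvaginOfImage.natCast_mem_and_isMinimal_of_split
    (C₂ • (D • E').quadraticTwist (d₁ : ℚ)) hK p hsp (dvd_refl p) v hv
  have hsgn : ∃ (u : ℤ) (hu : u = 1 ∨ u = -1), ϑ' = ϑ u m hm0 ∧
      ∀ (w : HeightOneSpectrum (𝓞 (ringClassField K ι m))), ((p : ℕ) : 𝓞 (ringClassField K ι m)) ∈ w.asIdeal →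
        (placeIntModel (C₂ • (D • E').quadraticTwist (d₁ : ℚ)) (ringClassField K ι m) w).HasNonsingularReduction
          (K := ringClassField K ι m) ((np * nm) • Y u hu m) := by
    rcases sq_eq_sq_iff_eq_or_eq_neg.mp (hϑ'2.trans (hϑ2 1 (Or.inl rfl) m hm0).symm) with h | h
    · exact ⟨1, Or.inl rfl, h, fun w hw ↦ by
        rw [mul_nsmul]
        exact Gross1991_heegnerPoint_sub_ratTorsion_mem_E0.hasNonsingularReduction_placeIntModel_nsmul _ w (hYp m hm hg w hw) nm⟩
    · refine ⟨-1, Or.inr rfl, ?_, fun w hw ↦ by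
        rw [mul_comm, mul_nsmul]
        exact Gross1991_heegnerPoint_sub_ratTorsion_mem_E0.hasNonsingularReduction_placeIntModel_nsmul _ w (hYm m hm hg w hw) np⟩
      rw [h, hϑdef, hϑdef]; push_cast; ring
  obtain ⟨u, hu, rfl, hE0Y⟩ := hsgn
  -- transport `E₀(K[m])_w (w ∣ p) → E0Receptacle (W⁄K) v` along `f`
  have key : ∀ P : ((C₂ • (D • E').quadraticTwist (d₁ : ℚ)).baseChange (ringClassField K ι m)).toAffine.Point, P = Y u hu m →
      ((np * nm : ℕ) : ℤ) • pointsMap ((C₂ • (D • E').quadraticTwist (d₁ : ℚ)).baseChange K) (v.adicCompletion K)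
        (Affine.Point.map (W' := C₂ • (D • E').quadraticTwist (d₁ : ℚ)) f P) ∈
        E0Receptacle ((C₂ • (D • E').quadraticTwist (d₁ : ℚ)).baseChange K) v := by
    rintro P rfl
    have h2 : ∀ (k : ℕ) (P : ((C₂ • (D • E').quadraticTwist (d₁ : ℚ)).baseChange (ringClassField K ι m)).toAffine.Point),
        pointsMap ((C₂ • (D • E').quadraticTwist (d₁ : ℚ)).baseChange K) (v.adicCompletion K)
            (Affine.Point.map (W' := C₂ • (D • E').quadraticTwist (d₁ : ℚ)) f (k • P)) =
          k • pointsMap ((C₂ • (D • E').quadraticTwist (d₁ : ℚ)).baseChange K) (v.adicCompletion K)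
            (Affine.Point.map (W' := C₂ • (D • E').quadraticTwist (d₁ : ℚ)) f P) := fun k P ↦
      map_nsmul ((pointsMap ((C₂ • (D • E').quadraticTwist (d₁ : ℚ)).baseChange K) (v.adicCompletion K)).comp
        (Affine.Point.map (W' := C₂ • (D • E').quadraticTwist (d₁ : ℚ)) f)) k P
    rw [natCast_zsmul, ← h2]
    exact Summit.BirchSwinnertonDyer.Rank1Residual.JET.pointsMap_map_mem_E0Receptacle_of_forall_place
      (C₂ • (D • E').quadraticTwist (d₁ : ℚ)) v hmin hNv f ((np * nm) • Y u hu m) hE0Y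
  exact key _ (by rw [hY u hu m hm0]; rfl)

end Summit.BirchSwinnertonDyer.BirchSwinnertonDyer.Theorems.GenusKolyvagin

end
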